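import Summits.BirchSwinnertonDyer.Rank1Residual.X11b.BDPRouteRelaxation
import HarnessLib

/-!
# Class X11b (cell `b2b-bsdres`'s `BDPRouteRelaxation`), ONE-CLASS FORM — RELAXING THE SELMER CONDITION AT ONE
# FINITE PLACE COSTS AT MOST THE LOCAL INDEX OF ONE RELAXED SELMER CLASS:
# `[H¹_{𝓛, ⊤ at v₀}(K, E[n]) : Sel⁽ⁿ⁾(E/K)] ≤ [E(K_{v₀}) : nE(K_{v₀}) + ℤ·P₀]` whenever `κ_{v₀}(P₀) = loc_{v₀} ξ`
# for ONE class `ξ ∈ H¹_{𝓛, ⊤ at v₀}` (Poitou–Tate). Written by seat `bsd-input-dkvd-coleman-zeta`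
# (literature-prover; LADDER-BSD «inputs→unconditional», input `Kato2004.hasLocPKummerLog_of_exists_log_ne_zero`
# of route `DerivedKatoValuationDoor`, crux stmt-BirchSwinnertonDyer-23024, line `birth`).

HONEST FRAMING. Theorems only (no definition, no named fact, no instance, no `sorry`); closes no item by
itself; nothing booked; X11b's labels unchanged; BSD is NOT proved by any of this. This file generalises
the sibling `X11b/BDPRouteRelaxation.lean`'s `relIndex_selmerGroup_kummerOutside_le` (Jetchev–Skinner–Wan
2017 Prop. 3.2.1, `≤` half, finite level), whose right-hand side is the local index of the GLOBAL POINTS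
`im E(K)`, to the local index of the Kummer coordinate `P₀ ∈ E(K_{v₀})` of ANY ONE GLOBAL CLASS `ξ` that is
Kummer away from `v₀` and localises at `v₀` to `κ_{v₀}(P₀)`. The point of the generalisation: the
Kurihara–Pollack line («the image of `H¹(ℚ, V_pE) → H¹(ℚ_p, V_pE)` is one-dimensional», LMS LN 320 (2007)
Lemma 1.4) is consumed by route `DerivedKatoValuationDoor` in the shape «ONE global class with a Kummer
localisation of non-zero logarithm makes EVERY global class Kummer at `p`»
(`Kato2004.hasLocPKummerLog_of_exists_log_ne_zero`); that global class is NOT a rational point in analytic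
rank `2`, so the tree's rational-point version (`Additive.LocPKummer.exists_hasLocPKummerLog_of_mem_integralH1`)
does not apply, but its Poitou–Tate engine does — with `κ(P)`, `P ∈ E(K)`, replaced by `ξ` (consumer:
`Additive/KatoDescentLocPKummerLogOfClass.lean`).

## What is proved (any number field `K`, any level `n ≥ 2`, any finite place `v₀`)

* §1 `invWeilPairing_localization_eq_zero_of_mem_kummerOutside₂` — ISOTROPY OF THE RELAXED SELMER GROUP
  AT `v₀`: for `x, ξ ∈ H¹_{𝓛, ⊤ at v₀}(K, E[n])` (`kummerOutside W n {v₀}`),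
  `inv_{v₀}(loc_{v₀} x ∪ₑ loc_{v₀} ξ) = 0` — every other local term of the Poitou–Tate sum
  `∑_v inv_v(x_v ∪ₑ ξ_v) = 0` vanishes because both classes are Kummer there (Poonen–Rains isotropy).
* §2 **`relIndex_selmerGroup_kummerOutside_le_index_zmultiples`** — for `ξ ∈ H¹_{𝓛, ⊤ at v₀}` with
  `loc_{v₀} ξ = κ_{n,v₀}(P₀)`, `P₀ ∈ E(K_{v₀})`:
  `[H¹_{𝓛, ⊤ at v₀} : Sel⁽ⁿ⁾] ≤ [E(K_{v₀}) : ℤ·P₀ + nE(K_{v₀})]`, given a Poitou–Tate family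
  (`IsPerfect`, `SumLocalTermEqZero`) and the count `#H¹(K_{v₀}, E[n]) = #𝓛_{v₀}²`; proof verbatim the
  tree's: the quotient embeds by `loc_{v₀}` into `N/𝓛_{v₀}`, `N` the annihilator of `ℤ·loc_{v₀} ξ` (§1),
  `#N·#(ℤ·loc ξ) = #H¹ = #𝓛²`, so `[N : 𝓛] = [𝓛 : ℤ·κ(P₀)] = [E(K_{v₀}) : ℤ·P₀ + nE(K_{v₀})]`.
* §3 `relIndex_selmerGroup_kummerOutside_le_index_zmultiples_of_facts` — the same from the two tree
  THEOREMS-as-hypotheses `poitouTate_sum_localTatePairing_eq_zero K` and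
  `localEulerPoincareCharacteristic K_{v₀}` (both discharged in the tree: `…_holds`), `n` a prime power.

References: [JetchevSkinnerWan2017] Prop. 3.2.1 (proof, arXiv:1512.06894 pp. 10–11); [MilneADT2006] I
Cor. 2.3, Thm. 2.8, Thm. 4.10 (b), Lemma 6.15; [PoonenRains2012] Prop. 4.8; [KuriharaPollack2007] §1.4
Lemma 1.4 (the line) and proof of Prop. 3.4 (2) (its use); tree `X11b/BDPRouteRelaxation.lean`.
-/

set_option autoImplicit false

noncomputable section

open scoped Classical

universe u

namespace Summit.BirchSwinnertonDyer.Rank1Residual.X11b.Relaxation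

open WeierstrassCurve Literature.NumberTheory.EllipticCurves Literature.NumberTheory.GaloisRepresentations
  Literature.NumberTheory.GaloisCohomology Field Function NumberField IsDedekindDomain
open Literature.NumberTheory.GaloisRepresentations.DiscreteGaloisModule (mu MuCarrier)
open Summit.BirchSwinnertonDyer.Rank1Residual.X11b.FiniteDuality
open scoped ContRepresentation

variable {K : Type u} [Field K] [NumberField K] (W : WeierstrassCurve K) [W.IsElliptic]
variable (n : ℕ) [NeZero n]

/-! ## §1 Isotropy of `loc_{v₀}(H¹_{𝓛, ⊤ at v₀})` -/

section WithPairing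

variable (e : geomTorsion W n → geomTorsion W n → AlgebraicClosure K)
  (hμ : ∀ S T, e S T ^ n = 1)
  (hadd₁ : ∀ S₁ S₂ T, e (S₁ + S₂) T = e S₁ T * e S₂ T)
  (hadd₂ : ∀ S T₁ T₂, e S (T₁ + T₂) = e S T₁ * e S T₂)
  (hgal : ∀ (σ : absoluteGaloisGroup K) (S T : geomTorsion W n), σ • e S T = e (σ • S) (σ • T))
  (halt : ∀ T, e T T = 1)
  (inv : LocalInvariants K n)

include halt in
/-- **Isotropy of the relaxed Selmer group at the relaxed place** (Poitou–Tate reciprocity): for two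
classes `x, ξ ∈ H¹(K, E[n])` satisfying the Kummer condition at every place `v ≠ v₀`
(`kummerOutside W n {v₀}`), `inv_{v₀}(loc_{v₀} x ∪ₑ loc_{v₀} ξ) = 0` — all other local terms of the
Poitou–Tate sum vanish by the isotropy of the local Kummer conditions, hence so does the one at `v₀`
(tree `sum_inv_weilCupProduct_localization_eq_zero`, `invWeilPairing_eq_zero_of_mem`). The tree's
`invWeilPairing_localization_eq_zero_of_mem_kummerOutside` is the case `ξ = κ(P)`, `P ∈ E(K)`.
[cite: MilneADT2006, Ch. I, Thm. 4.10(b)] [cite: JetchevSkinnerWan2017, Prop. 3.2.1 (proof)] -/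
theorem invWeilPairing_localization_eq_zero_of_mem_kummerOutside₂ (hPT : inv.SumLocalTermEqZero)
    (v₀ : Place K) {x ξ : galoisCohomology (W.torsionGaloisModule n) 1}
    (hx : x ∈ kummerOutside W n {v₀}) (hξ : ξ ∈ kummerOutside W n {v₀}) :
    invWeilPairing W n e hμ hadd₁ hadd₂ hgal inv v₀
      (galoisCohomology.localization (W.torsionGaloisModule n) v₀ 1 x)
      (galoisCohomology.localization (W.torsionGaloisModule n) v₀ 1 ξ) = 0 := by
  -- the cup products at the places `v ∉ {v₀}` (hypothesis `hS` of the tree's Poitou–Tate sum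
  -- `sum_inv_weilCupProduct_localization_eq_zero`) need `LocallyCompactSpace Γ_{K_v}`: the compactness of
  -- absolute Galois groups (`absoluteGaloisGroup_compactSpace`) is supplied proof-locally, as the tree's
  -- cup-product files supply it file-locally
  have _hΓ : ∀ (L : Type u) [Field L], CompactSpace (absoluteGaloisGroup L) := fun L _ =>
    absoluteGaloisGroup_compactSpace L
  have hS : ∀ v ∉ ({v₀} : Finset (Place K)), inv v ((weilContPairingLocal W n e hμ hadd₁ hadd₂ hgal v).cupProduct
      (galoisCohomology.localization (W.torsionGaloisModule n) v 1 x)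
      (galoisCohomology.localization (W.torsionGaloisModule n) v 1 ξ)) = 0 := by
    intro v hv
    have hxv : galoisCohomology.localization (W.torsionGaloisModule n) v 1 x ∈ W.kummerSelmerStructure n v :=
      (mem_kummerOutside_iff W n {v₀} x).mp hx v hv
    have hξv : galoisCohomology.localization (W.torsionGaloisModule n) v 1 ξ ∈ W.kummerSelmerStructure n v :=
      (mem_kummerOutside_iff W n {v₀} ξ).mp hξ v hv
    exact invWeilPairing_eq_zero_of_mem W n e hμ hadd₁ hadd₂ hgal halt inv v hxv hξv
  have h := sum_inv_weilCupProduct_localization_eq_zero W n e hμ hadd₁ hadd₂ hgal inv hPT x ξ {v₀} hS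
  rwa [Finset.sum_singleton] at h

end WithPairing

/-! ## §2 The relaxation inequality with the local index of ONE class -/

section Main

variable (v₀ : HeightOneSpectrum (𝓞 K))

/-- **RELAXING THE SELMER CONDITION AT ONE FINITE PLACE COSTS AT MOST THE LOCAL INDEX OF ONE RELAXED
SELMER CLASS.** For an elliptic curve `E = W` over a number field `K`, a level `n ≥ 2`, a finite place
`v₀`, a Poitou–Tate family `inv` (`IsPerfect` and `SumLocalTermEqZero`) and the count
`#H¹(K_{v₀}, E[n]) = #𝓛_{v₀}²` (Tate's local Euler–Poincaré characteristic): if ONE class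
`ξ ∈ H¹_{𝓛, ⊤ at v₀}(K, E[n])` (`kummerOutside W n {v₀}`: Kummer at every place `≠ v₀`) localises at
`v₀` to the local Kummer class of `P₀ ∈ E(K_{v₀})`, then

  `[H¹_{𝓛, ⊤ at v₀}(K, E[n]) : Sel⁽ⁿ⁾(E/K)] ≤ [E(K_{v₀}) : ℤ·P₀ + n E(K_{v₀})]`.

Proof (verbatim the tree's `relIndex_selmerGroup_kummerOutside_le` with `κ(E(K))` replaced by `ℤ·ξ`):
`x ↦ loc_{v₀} x` embeds the quotient into `(loc(H¹_{𝓛,⊤}) + 𝓛_{v₀})/𝓛_{v₀} ⊆ N/𝓛_{v₀}`, `N` the annihilator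
of `ℤ·loc_{v₀} ξ` under `inv_{v₀}(· ∪ₑ ·)` (§1 isotropy for `loc(H¹_{𝓛,⊤})`, Poonen–Rains isotropy for
`𝓛_{v₀}`); `#N·#(ℤ·loc ξ) = #H¹(K_{v₀},E[n]) = #𝓛²` (perfectness + Euler characteristic), so
`[N : 𝓛] = [𝓛 : ℤ·κ(P₀)] = [E(K_{v₀}) : ℤ·P₀ + nE(K_{v₀})]` (`ker κ_{n,v₀} = nE(K_{v₀})`). This is the
finite-level, one-class form of «`dim im(H¹(K,V) → H¹(K_{v₀},V)) = dim coker`» (Kurihara–Pollack 2007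
Lemma 1.4 / Jetchev–Skinner–Wan 2017 Prop. 3.2.1).
[cite: JetchevSkinnerWan2017, Prop. 3.2.1 (proof, arXiv:1512.06894 pp. 10–11)]
[cite: KuriharaPollack2007, §1.4 Lemma 1.4] [cite: MilneADT2006, Ch. I, Thm. 4.10(b), Cor. 2.3, Thm. 2.8] -/
theorem relIndex_selmerGroup_kummerOutside_le_index_zmultiples (hn2 : 2 ≤ n)
    (inv : LocalInvariants K n) (hperf : inv.IsPerfect) (hPT : inv.SumLocalTermEqZero)
    (hEuler : Nat.card (galoisCohomology ((W.torsionGaloisModule n).toLocal (Sum.inr v₀)) 1) =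
      (Nat.card (nsmulAddMonoidHom n : (W.baseChange (v₀.adicCompletion K)).toAffine.Point →+ _).ker *
        Nat.card (v₀.adicCompletionIntegers K ⧸ Ideal.span {(n : v₀.adicCompletionIntegers K)})) ^ 2)
    {ξ : galoisCohomology (W.torsionGaloisModule n) 1} (hξ : ξ ∈ kummerOutside W n {Sum.inr v₀})
    (P₀ : (W.baseChange (v₀.adicCompletion K)).toAffine.Point)
    (hξP₀ : galoisCohomology.localization (W.torsionGaloisModule n) (Sum.inr v₀) 1 ξ =
      W.localKummerMap (v₀.adicCompletion K) (Int.natCast_ne_zero.mpr (NeZero.ne n)) P₀) :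
    (selmerGroup W (n : ℤ)).relIndex (kummerOutside W n {Sum.inr v₀}) ≤
      (AddSubgroup.zmultiples P₀ ⊔
        (zsmulAddGroupHom (n : ℤ) : (W.baseChange (v₀.adicCompletion K)).toAffine.Point →+ _).range).index := by
  classical
  haveI : PerfectField K := PerfectField.ofCharZero
  haveI : CharZero (v₀.adicCompletion K) := charZero_adicCompletion v₀
  haveI : Finite (geomTorsion W n) := finite_geomTorsion_of_neZero W n
  have hnZ : (n : ℤ) ≠ 0 := Int.natCast_ne_zero.mpr (NeZero.ne n)
  obtain ⟨e, hμ, hadd₁, hadd₂, halt, hnondeg, hgal⟩ :=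
    exists_weilPairing_holds W n hn2 (by exact_mod_cast NeZero.ne n)
  -- the localisation hypothesis read through `res` at `K_{v₀}` (definitionally the same map)
  have hξP₀' : galoisCohomology.res (W.torsionGaloisModule n) (v₀.adicCompletion K) 1 ξ =
      W.localKummerMap (v₀.adicCompletion K) hnZ P₀ := hξP₀
  -- §1 isotropy for the pair `(x, ξ)`, `x ∈ KO`
  have hiso : ∀ x ∈ kummerOutside W n {Sum.inr v₀},
      invWeilPairing W n e hμ hadd₁ hadd₂ hgal inv (Sum.inr v₀)
        (galoisCohomology.localization (W.torsionGaloisModule n) (Sum.inr v₀) 1 x)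
        (galoisCohomology.localization (W.torsionGaloisModule n) (Sum.inr v₀) 1 ξ) = 0 := fun x hx =>
    invWeilPairing_localization_eq_zero_of_mem_kummerOutside₂ W n e hμ hadd₁ hadd₂ hgal halt inv hPT
      (Sum.inr v₀) hx hξ
  -- notation
  set loc := galoisCohomology.localization (W.torsionGaloisModule n) (Sum.inr v₀) 1 with hloc
  set b := invWeilPairing W n e hμ hadd₁ hadd₂ hgal inv (Sum.inr v₀) with hb
  set L := W.kummerSelmerStructure n (Sum.inr v₀) with hL
  set KO := kummerOutside W n {Sum.inr v₀} with hKO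
  set Hξ : AddSubgroup (galoisCohomology ((W.torsionGaloisModule n).toLocal (Sum.inr v₀)) 1) :=
    AddSubgroup.zmultiples (loc ξ) with hHξ
  set N := annLeft b Hξ with hN
  haveI hfinA : Finite (galoisCohomology ((W.torsionGaloisModule n).toLocal (Sum.inr v₀)) 1) := by
    change Finite (galoisCohomology (GaloisRep.restrictField (v₀.adicCompletion K) (W.torsionGaloisModule n)) 1)
    exact finite_galoisCohomology_one_of_isNonarchimedeanLocalField _
  -- (1) `Sel = comap L ⊓ KO`
  have hSel : selmerGroup W (n : ℤ) = L.comap loc ⊓ KO := by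
    apply le_antisymm
    · intro c hc
      exact ⟨(W.mem_selmerGroup_iff_forall_localization_mem n c).mp hc (Sum.inr v₀),
        selmerGroup_le_kummerOutside W n _ hc⟩
    · rintro c ⟨hc₀, hcKO⟩
      refine mem_selmerGroup_of_mem_kummerOutside W n hcKO fun v => ?_
      obtain ⟨v, hv⟩ := v
      rw [Finset.mem_singleton] at hv
      subst hv
      exact hc₀
  -- (2) the relative index through `loc`
  have h2' : (L.comap loc ⊓ KO).relIndex KO = L.relIndex (L ⊔ KO.map loc) := by
    rw [AddSubgroup.inf_relIndex_right, AddSubgroup.relIndex_comap, AddSubgroup.relIndex_sup_left]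
  have h2 : (selmerGroup W (n : ℤ)).relIndex KO = L.relIndex (L ⊔ KO.map loc) := by
    rw [hSel]; exact h2'
  -- (3) `Hξ ≤ L`, `KO.map loc ≤ N` (§1) and `L ≤ N`
  have hξL : loc ξ ∈ L := by
    change galoisCohomology.res (W.torsionGaloisModule n) (v₀.adicCompletion K) 1 ξ ∈
      W.kummerLocalConditionAt n (v₀.adicCompletion K)
    rw [hξP₀']
    exact W.localKummerMap_mem _ _ _
  have hHξL : Hξ ≤ L := (AddSubgroup.zmultiples_le_of_mem hξL)
  have hKON : KO.map loc ≤ N := by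
    rintro _ ⟨x, hx, rfl⟩
    rw [hN, mem_annLeft_iff]
    intro y hy
    obtain ⟨m, rfl⟩ := AddSubgroup.mem_zmultiples_iff.mp hy
    have h0 : b (loc x) (loc ξ) = 0 := hiso x hx
    rw [map_zsmul, h0, smul_zero]
  have hLN : L ≤ N := by
    intro x hx
    rw [hN, mem_annLeft_iff]
    intro y hy
    exact invWeilPairing_eq_zero_of_mem W n e hμ hadd₁ hadd₂ hgal halt inv (Sum.inr v₀) hx (hHξL hy)
  have hXN : L ⊔ KO.map loc ≤ N := sup_le hLN hKON
  -- (4) `[L ⊔ loc KO : L] ≤ [N : L]`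
  haveI : Finite N := inferInstance
  have hXNne : (L ⊔ KO.map loc).relIndex N ≠ 0 := AddSubgroup.FiniteIndex.index_ne_zero
  have h4 : L.relIndex (L ⊔ KO.map loc) ≤ L.relIndex N := by
    have := AddSubgroup.relIndex_mul_relIndex L (L ⊔ KO.map loc) N le_sup_left hXN
    exact Nat.le_of_dvd (Nat.pos_of_ne_zero (by
      rw [← this]; exact mul_ne_zero (by
        intro h0; rw [h0, zero_mul] at this
        exact (AddSubgroup.FiniteIndex.index_ne_zero (H := L.addSubgroupOf N)) this.symm) hXNne))
      (Dvd.intro _ this)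
  -- (5) `#N · #Hξ = #A = #L²`, so `[N : L] = [L : Hξ]`
  have hA : ∀ x : galoisCohomology ((W.torsionGaloisModule n).toLocal (Sum.inr v₀)) 1, n • x = 0 :=
    nsmul_continuousCohomology_one_eq_zero _ n (fun T : geomTorsion W n => AddSubgroup.torsionBy.nsmul T)
  have hbij : Bijective b := invWeilPairing_bijective W n e hμ hadd₁ hadd₂ hgal hnondeg inv v₀ (hperf v₀).1.1
  have hNH : Nat.card N * Nat.card Hξ =
      Nat.card (galoisCohomology ((W.torsionGaloisModule n).toLocal (Sum.inr v₀)) 1) :=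
    natCard_annLeft_mul hA b hbij Hξ
  have hLcard : Nat.card L = Nat.card (nsmulAddMonoidHom n :
        (W.baseChange (v₀.adicCompletion K)).toAffine.Point →+ _).ker *
      Nat.card (v₀.adicCompletionIntegers K ⧸ Ideal.span {(n : v₀.adicCompletionIntegers K)}) :=
    W.natCard_kummerSelmerStructure_inr v₀ (NeZero.ne n)
  have hAL : Nat.card (galoisCohomology ((W.torsionGaloisModule n).toLocal (Sum.inr v₀)) 1) =
      Nat.card L * Nat.card L := by
    rw [hEuler, hLcard, sq]
  -- `[N : L] · #L = #N`, `[L : Hξ] · #Hξ = #L`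
  have hNL : L.relIndex N * Nat.card L = Nat.card N := by
    rw [AddSubgroup.relIndex, mul_comm, ← Nat.card_congr (AddSubgroup.addSubgroupOfEquivOfLe hLN).toEquiv]
    exact AddSubgroup.card_mul_index _
  have hLH : Hξ.relIndex L * Nat.card Hξ = Nat.card L := by
    rw [AddSubgroup.relIndex, mul_comm, ← Nat.card_congr (AddSubgroup.addSubgroupOfEquivOfLe hHξL).toEquiv]
    exact AddSubgroup.card_mul_index _
  have hLpos : 0 < Nat.card L := Nat.card_pos
  have hHpos : 0 < Nat.card Hξ := Nat.card_pos
  have h5 : L.relIndex N = Hξ.relIndex L := by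
    have key : L.relIndex N * Nat.card L * Nat.card Hξ = Hξ.relIndex L * Nat.card Hξ * Nat.card L := by
      rw [hNL, hNH, hAL, hLH]
    have : L.relIndex N * (Nat.card L * Nat.card Hξ) = Hξ.relIndex L * (Nat.card L * Nat.card Hξ) := by
      rw [← mul_assoc, key]; ring
    exact Nat.eq_of_mul_eq_mul_right (Nat.mul_pos hLpos hHpos) this
  -- (6) the local index of the one class: `[L : ℤ·κ(P₀)] = [E(K_{v₀}) : ℤ·P₀ + nE(K_{v₀})]`
  have h6 : Hξ.relIndex L = (AddSubgroup.zmultiples P₀ ⊔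
      (zsmulAddGroupHom (n : ℤ) : (W.baseChange (v₀.adicCompletion K)).toAffine.Point →+ _).range).index := by
    change (AddSubgroup.zmultiples
        (galoisCohomology.res (W.torsionGaloisModule n) (v₀.adicCompletion K) 1 ξ)).relIndex
        (W.kummerLocalConditionAt n (v₀.adicCompletion K)) = _
    rw [hξP₀', ← AddMonoidHom.map_zmultiples, ← W.range_localKummerMap (v₀.adicCompletion K) hnZ,
      KummerIndex.relIndex_map_range_eq_index_sup_ker,
      W.ker_localKummerMap (v₀.adicCompletion K) hnZ]
  calc (selmerGroup W (n : ℤ)).relIndex KO = L.relIndex (L ⊔ KO.map loc) := h2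
    _ ≤ L.relIndex N := h4
    _ = Hξ.relIndex L := h5
    _ = _ := h6

/-! ## §3 The same from the two (discharged) named facts -/

/-- **The relaxation inequality from Poitou–Tate and the local Euler–Poincaré characteristic**
(`poitouTate_sum_localTatePairing_eq_zero K`, Milne I Thm. 4.10 (b) with Cor. 2.3;
`localEulerPoincareCharacteristic K_{v₀}`, Milne I Thm. 2.8 — both are THEOREMS of the tree, fed as
hypotheses here so that the statement stays family-free), for a prime power `n`: if ONE class of
`H¹_{𝓛, ⊤ at v₀}(K, E[n])` localises at `v₀` to `κ_{n,v₀}(P₀)`, then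
`[H¹_{𝓛, ⊤ at v₀}(K, E[n]) : Sel⁽ⁿ⁾(E/K)] ≤ [E(K_{v₀}) : ℤ·P₀ + nE(K_{v₀})]`.
[cite: JetchevSkinnerWan2017, Prop. 3.2.1 (proof, arXiv:1512.06894 pp. 10–11)]
[cite: KuriharaPollack2007, §1.4 Lemma 1.4] [cite: MilneADT2006, Ch. I, Thm. 4.10(b) and Thm. 2.8] -/
theorem relIndex_selmerGroup_kummerOutside_le_index_zmultiples_of_facts (hn : IsPrimePow n)
    (hPT : poitouTate_sum_localTatePairing_eq_zero K)
    (hEP : localEulerPoincareCharacteristic (v₀.adicCompletion K))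
    {ξ : galoisCohomology (W.torsionGaloisModule n) 1} (hξ : ξ ∈ kummerOutside W n {Sum.inr v₀})
    (P₀ : (W.baseChange (v₀.adicCompletion K)).toAffine.Point)
    (hξP₀ : galoisCohomology.localization (W.torsionGaloisModule n) (Sum.inr v₀) 1 ξ =
      W.localKummerMap (v₀.adicCompletion K) (Int.natCast_ne_zero.mpr (NeZero.ne n)) P₀) :
    (selmerGroup W (n : ℤ)).relIndex (kummerOutside W n {Sum.inr v₀}) ≤
      (AddSubgroup.zmultiples P₀ ⊔
        (zsmulAddGroupHom (n : ℤ) : (W.baseChange (v₀.adicCompletion K)).toAffine.Point →+ _).range).index := by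
  obtain ⟨inv, hperf, hsum⟩ := hPT n
  have hn2 : 2 ≤ n := by
    obtain ⟨p, k, hp, hk, rfl⟩ := hn
    calc 2 ≤ p := (Nat.prime_iff.mpr hp).two_le
      _ = p ^ 1 := (pow_one p).symm
      _ ≤ p ^ k := Nat.pow_le_pow_right (Nat.prime_iff.mpr hp).pos hk
  exact relIndex_selmerGroup_kummerOutside_le_index_zmultiples W n v₀ hn2 inv hperf hsum
    (natCard_galoisCohomology_one_torsion_adicCompletion_eq_sq W v₀ n hn hEP) hξ P₀ hξP₀

end Main

end Summit.BirchSwinnertonDyer.Rank1Residual.X11b.Relaxation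

end
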